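import Mathlib
import Summits.ValiantsHypothesis.ValiantsHypothesis.Theses.KPlusLogSqLaw
import Summits.ValiantsHypothesis.ValiantsHypothesis.Theorems.MatrixDescartes.Negative.MatrixDescartesFalseOfTropicalMonster
import Summits.ValiantsHypothesis.ValiantsHypothesis.Theorems.LacunarySymmetroidMatrixDescartesCensusKLawBridge
import Summits.ValiantsHypothesis.ValiantsHypothesis.Theorems.LacunarySymmetroidMatrixDescartesCensusFrame
import Summits.ValiantsHypothesis.ValiantsHypothesis.Theorems.LacunarySymmetroidMatrixDescartesCensusClassicalRows
import Summits.ValiantsHypothesis.ValiantsHypothesis.Theorems.LacunarySymmetroidAssembly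
import Summits.ValiantsHypothesis.ValiantsHypothesis.Theorems.LacunarySymmetroidPencilTransfer
import Summits.ValiantsHypothesis.ValiantsHypothesis.Theorems.LacunarySymmetroidThetaWitness

set_option linter.dupNamespace false
set_option autoImplicit false

/-!
# The `Assembly` item of route «KPlusLogSqLaw» (route-ValiantsHypothesis-KPlusLogSqLaw)

`TropicalB → Lifting → VP_ℂ ≠ VNP_ℂ`: the tropical `K + log² m` law and format-level lifting give the real law
`KPlusLogSqLaw` (with `C = C_L + C_T + 2`), hence `MatrixDescartes` (`Census.matrixDescartes_of_kPlusLogSqLaw`), hence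
Valiant's hypothesis by the LacunarySymmetroid assembly with its two closed items `pencilTransfer_proof`, `thetaWitness_proof`.
Sorry-free; axioms propext / Classical.choice / Quot.sound. (conjb-2 g2, 2026-08-25.)
-/

namespace Summit.ValiantsHypothesis.ValiantsHypothesis.Theorems.KPlusLogSqLaw

open Summit.ValiantsHypothesis.ValiantsHypothesis.Theses.KPlusLogSqLaw (TropicalB Lifting Assembly closes)
open Summit.ValiantsHypothesis.ValiantsHypothesis.Theorems.LacunarySymmetroidMatrixDescartes (RealRootLawAt KPlusLogSqLaw)

/-- TB ∧ LIFT ⟹ B (the real `K + log² m` law), with `C = C_L + C_T + 2`. -/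
theorem kPlusLogSqLaw_of (hT : TropicalB) (hL : Lifting) : KPlusLogSqLaw := by
  obtain ⟨CT, hT⟩ := hT
  obtain ⟨CL, hL⟩ := hL
  refine ⟨CL + CT + 2, fun m K => ?_⟩
  have h1 := hL m K (2 ^ (CT * (K + Nat.log 2 m ^ 2))) (hT m K)
  rcases Nat.eq_zero_or_pos K with hK | hK
  · subst hK
    intro d S _
    have h0 : (∑ l : Fin 0, ((Polynomial.X : Polynomial ℝ) ^ d l) • (S l).map Polynomial.C) = 0 := by simp
    rw [h0]
    rcases Nat.eq_zero_or_pos m with hm | hm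
    · subst hm; simp [Matrix.det_isEmpty]
    · haveI : Nonempty (Fin m) := ⟨⟨0, hm⟩⟩
      simp [Matrix.det_zero]
  · refine Summit.ValiantsHypothesis.ValiantsHypothesis.Theorems.LacunarySymmetroidMatrixDescartes.Census.realRootLawAt_mono ?_ h1
    have e1 : 2 ^ (CT * (K + Nat.log 2 m ^ 2)) + 1 ≤ 2 ^ (CT * (K + Nat.log 2 m ^ 2) + 1) :=
      Nat.pow_lt_pow_right (by norm_num) (Nat.lt_succ_self _)
    calc 2 ^ (CL * K) * (2 ^ (CT * (K + Nat.log 2 m ^ 2)) + 1)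
        ≤ 2 ^ (CL * K) * 2 ^ (CT * (K + Nat.log 2 m ^ 2) + 1) := Nat.mul_le_mul_left _ e1
      _ = 2 ^ (CL * K + (CT * (K + Nat.log 2 m ^ 2) + 1)) := (pow_add _ _ _).symm
      _ ≤ 2 ^ ((CL + CT + 2) * (K + Nat.log 2 m ^ 2)) :=
        Nat.pow_le_pow_right (by norm_num) (by nlinarith [hK, Nat.zero_le (CL * Nat.log 2 m ^ 2), Nat.zero_le (Nat.log 2 m ^ 2)])

/-- the `Assembly` item holds. -/
theorem assembly_proof : Assembly := fun hT hL =>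
  Summit.ValiantsHypothesis.ValiantsHypothesis.Theorems.lacunarySymmetroid_assembly_proof
    (Summit.ValiantsHypothesis.ValiantsHypothesis.Theorems.LacunarySymmetroidMatrixDescartes.Census.matrixDescartes_of_kPlusLogSqLaw
      (kPlusLogSqLaw_of hT hL))
    Summit.ValiantsHypothesis.ValiantsHypothesis.Theorems.LacunarySymmetroid.pencilTransfer_proof
    Summit.ValiantsHypothesis.ValiantsHypothesis.Theorems.LacunarySymmetroid.thetaWitness_proof

/-- hence the route's deciding chain is `TropicalB → Lifting → VP ≠ VNP` with no further input. -/
theorem valiant_of (hT : TropicalB) (hL : Lifting) : _root_.ValiantsHypothesis :=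
  -- buildfix 2026-08-26 (proof-only): the route's `closes` was re-cut 08:43Z to `(hT : TropicalB) (hW : WeakLifting)`,
  -- so this corollary is now read straight off the assembly item.
  assembly_proof hT hL

end Summit.ValiantsHypothesis.ValiantsHypothesis.Theorems.KPlusLogSqLaw
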